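import Summits.MatrixMultiplication.Statement
import Summits.MatrixMultiplication.MatrixMultiplication.Theses.IsotypicSaturation
import Literature.Computability.AlgebraicComplexity.DegenerationSpectralMonotone
import Literature.Computability.AlgebraicComplexity.StrassenPreorderClosure

/-!
# Birth skeleton — crux `DominationLifting` (piece 2 of the split of `PolytopeSaturation`,
route IsotypicSaturation): the TWIN-DEGENERATION line

`DominationLifting`: if `s` is dominated by `t` (`Δ(s) ⊆ Δ(t)`, read through occurring partition
triples) then some polytope-twins `s₁ ≡ s`, `t₁ ≡ t` satisfy `[s₁] ≲ [t₁]` in `T(ℂ)` (Strassen's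
asymptotic preorder `AsympLe (· ≤ ·)` on `TensorClass ℂ`).

Line: realise the lift by an honest DEGENERATION between twins (`AlgDegeneratesTo t₁ s₁`, the tree's
`K[ε]`-degeneration of Bürgisser–Clausen–Shokrollahi (15.19)); degenerations are asymptotic
restrictions with polynomial slack (`s₁^{⊗N} ≤ t₁^{⊗N} ⊗ M_{Nh}`, `R(M_{Nh}) ≤ (Nh+1)²`, Bini/Strassen).
Candidate mechanism for the pair that decides `ω` (`s = ⟨2,2,2⟩`, `t = ⟨4⟩`, `Δ(⟨4⟩) = Kron(4,4,4)`):
`s₁ := ⟨2,2,2⟩`, `t₁ := ⟨2,2,2⟩ + y` with `y ≠ 0` of positive weight for a one-parameter subgroup of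
the stabiliser of `⟨2,2,2⟩` (e.g. `y ∈ span{e_{1b} ⊗ e_{cd} ⊗ e_{e2}}` for `P = diag(τ,1)` acting on
the first matrix factor): `λ(τ⁻¹)·t₁ = ⟨2,2,2⟩ + τ^{-w} y → ⟨2,2,2⟩`, so `t₁ ⊵ ⟨2,2,2⟩`; the line then
needs ONE moment-polytope computation, `Δ(t₁) = Kron(4,4,4)` (a dense-open condition on `t₁`),
to make `t₁` a twin of `⟨4⟩`.

* `stub_twinDegenerationCover` (OPEN, the crux of the line): domination is covered by a degeneration
  between twins. Why it might fail: the twins of a tensor with NON-maximal polytope are confined to a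
  proper closed `GL³`-stable set whose members may all have border rank too small to degenerate to any
  twin of `s`.
* `stub_asympLe_of_algDegeneratesTo` (provable-now, size M): `t₁ ⊵ s₁ ⟹ [s₁] ≲ [t₁]`
  (`IsApproxRestriction.exists_kroneckerPow`, `restrictsTo_kronecker_coeffTensor`,
  `tensorRank_coeffTensor_le`: `[s₁]^N ≤ (Nh+1)²·[t₁]^N`, and `N ↦ (Nh+1)²` is subexponential).
* `DominationLifting_of`: composition (kernel-checked).

Disproof used: none registered for this crux yet (no `Disproof.lean`).
-/

set_option linter.dupNamespace false

noncomputable section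

namespace Summit.MatrixMultiplication.MatrixMultiplication.Cruxes.DominationLifting.Birth

open Literature.Computability.AlgebraicComplexity

/-- The crux, verbatim (route decl `Theses.IsotypicSaturation.DominationLifting` after the split). -/
def DominationLifting : Prop :=
  ∀ {ι κ μ ι' κ' μ' : Type} [Fintype ι] [Fintype κ] [Fintype μ] [Fintype ι'] [Fintype κ'] [Fintype μ'] (s : ι → κ → μ → ℂ) (t : ι' → κ' → μ' → ℂ), (∀ (n : ℕ) (lam : Fin 3 → Nat.Partition n), 0 < n → Literature.Computability.AlgebraicComplexity.isotypicSum₁ (lam 0) (Literature.Computability.AlgebraicComplexity.isotypicSum₂ (lam 1) (Literature.Computability.AlgebraicComplexity.isotypicSum₃ (lam 2) (Literature.Computability.AlgebraicComplexity.kroneckerPow s n))) ≠ 0 → ∃ (k : ℕ) (mu : Fin 3 → Nat.Partition (k * n)), 0 < k ∧ (∀ j, (mu j).parts = (lam j).parts.map (fun p => k * p)) ∧ Literature.Computability.AlgebraicComplexity.isotypicSum₁ (mu 0) (Literature.Computability.AlgebraicComplexity.isotypicSum₂ (mu 1) (Literature.Computability.AlgebraicComplexity.isotypicSum₃ (mu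 2) (Literature.Computability.AlgebraicComplexity.kroneckerPow t (k * n)))) ≠ 0) → ∃ (ι₁ κ₁ μ₁ ι₂ κ₂ μ₂ : Type) (_ : Fintype ι₁) (_ : Fintype κ₁) (_ : Fintype μ₁) (_ : Fintype ι₂) (_ : Fintype κ₂) (_ : Fintype μ₂) (s₁ : ι₁ → κ₁ → μ₁ → ℂ) (t₁ : ι₂ → κ₂ → μ₂ → ℂ), (∀ (n : ℕ) (lam : Fin 3 → Nat.Partition n), 0 < n → Literature.Computability.AlgebraicComplexity.isotypicSum₁ (lam 0) (Literature.Computability.AlgebraicComplexity.isotypicSum₂ (lam 1) (Literature.Computability.AlgebraicComplexity.isotypicSum₃ (lam 2) (Literature.Computability.AlgebraicComplexity.kroneckerPow s n))) ≠ 0 → ∃ (k : ℕ) (mu : Fin 3 → Nat.Partition (k * n)), 0 < k ∧ (∀ j, (mu j).parts = (lam j).parts.map (fun p => k * p)) ∧ Literature.Computability.AlgebraicComplexity.isotypicSum₁ (mu 0) (Literature.Computability.AlgebraicComplexity.isotypicSum₂ (mu 1) (Literature.Computability.AlgebraicComplexity.isotypicSum₃ (mu 2) (Literature.Computability.AlgebraicComplexity.kroneckerPow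 s₁ (k * n)))) ≠ 0) ∧ (∀ (n : ℕ) (lam : Fin 3 → Nat.Partition n), 0 < n → Literature.Computability.AlgebraicComplexity.isotypicSum₁ (lam 0) (Literature.Computability.AlgebraicComplexity.isotypicSum₂ (lam 1) (Literature.Computability.AlgebraicComplexity.isotypicSum₃ (lam 2) (Literature.Computability.AlgebraicComplexity.kroneckerPow s₁ n))) ≠ 0 → ∃ (k : ℕ) (mu : Fin 3 → Nat.Partition (k * n)), 0 < k ∧ (∀ j, (mu j).parts = (lam j).parts.map (fun p => k * p)) ∧ Literature.Computability.AlgebraicComplexity.isotypicSum₁ (mu 0) (Literature.Computability.AlgebraicComplexity.isotypicSum₂ (mu 1) (Literature.Computability.AlgebraicComplexity.isotypicSum₃ (mu 2) (Literature.Computability.AlgebraicComplexity.kroneckerPow s (k * n)))) ≠ 0) ∧ (∀ (n : ℕ) (lam : Fin 3 → Nat.Partition n), 0 < n → Literature.Computability.AlgebraicComplexity.isotypicSum₁ (lam 0) (Literature.Computability.AlgebraicComplexity.isotypicSum₂ (lam 1) (Literature.Computability.AlgebraicComplexity.isotypicSum₃ (lam 2) (Literature.Computability.AlgebraicComplexity.kroneckerPow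 t n))) ≠ 0 → ∃ (k : ℕ) (mu : Fin 3 → Nat.Partition (k * n)), 0 < k ∧ (∀ j, (mu j).parts = (lam j).parts.map (fun p => k * p)) ∧ Literature.Computability.AlgebraicComplexity.isotypicSum₁ (mu 0) (Literature.Computability.AlgebraicComplexity.isotypicSum₂ (mu 1) (Literature.Computability.AlgebraicComplexity.isotypicSum₃ (mu 2) (Literature.Computability.AlgebraicComplexity.kroneckerPow t₁ (k * n)))) ≠ 0) ∧ (∀ (n : ℕ) (lam : Fin 3 → Nat.Partition n), 0 < n → Literature.Computability.AlgebraicComplexity.isotypicSum₁ (lam 0) (Literature.Computability.AlgebraicComplexity.isotypicSum₂ (lam 1) (Literature.Computability.AlgebraicComplexity.isotypicSum₃ (lam 2) (Literature.Computability.AlgebraicComplexity.kroneckerPow t₁ n))) ≠ 0 → ∃ (k : ℕ) (mu : Fin 3 → Nat.Partition (k * n)), 0 < k ∧ (∀ j, (mu j).parts = (lam j).parts.map (fun p => k * p)) ∧ Literature.Computability.AlgebraicComplexity.isotypicSum₁ (mu 0) (Literature.Computability.AlgebraicComplexity.isotypicSum₂ (mu 1) (Literature.Computability.AlgebraicComplexity.isotypicSum₃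 (mu 2) (Literature.Computability.AlgebraicComplexity.kroneckerPow t (k * n)))) ≠ 0) ∧ Literature.Computability.AlgebraicComplexity.AsympLe (fun x y : Literature.Computability.AlgebraicComplexity.TensorClass ℂ => x ≤ y) (Literature.Computability.AlgebraicComplexity.TensorClass.mk s₁) (Literature.Computability.AlgebraicComplexity.TensorClass.mk t₁)

/-- **stub 1 — twin degeneration cover** (OPEN): if `s` is dominated by `t` then some twin `t₁` of
`t` degenerates (over `ℂ[ε]`) to some twin `s₁` of `s`. [size XL] -/
theorem stub_twinDegenerationCover :
    ∀ {ι κ μ ι' κ' μ' : Type} [Fintype ι] [Fintype κ] [Fintype μ] [Fintype ι'] [Fintype κ'] [Fintype μ']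
        (s : ι → κ → μ → ℂ) (t : ι' → κ' → μ' → ℂ),
        (∀ (n : ℕ) (lam : Fin 3 → Nat.Partition n), 0 < n → isotypicSum₁ (lam 0) (isotypicSum₂ (lam 1) (isotypicSum₃ (lam 2) (kroneckerPow s n))) ≠ 0 → ∃ (k : ℕ) (mu : Fin 3 → Nat.Partition (k * n)), 0 < k ∧ (∀ j, (mu j).parts = (lam j).parts.map (fun p => k * p)) ∧ isotypicSum₁ (mu 0) (isotypicSum₂ (mu 1) (isotypicSum₃ (mu 2) (kroneckerPow t (k * n)))) ≠ 0) →
        ∃ (ι₁ κ₁ μ₁ ι₂ κ₂ μ₂ : Type) (_ : Fintype ι₁) (_ : Fintype κ₁) (_ : Fintype μ₁) (_ : Fintype ι₂)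
          (_ : Fintype κ₂) (_ : Fintype μ₂) (s₁ : ι₁ → κ₁ → μ₁ → ℂ) (t₁ : ι₂ → κ₂ → μ₂ → ℂ),
          (∀ (n : ℕ) (lam : Fin 3 → Nat.Partition n), 0 < n → isotypicSum₁ (lam 0) (isotypicSum₂ (lam 1) (isotypicSum₃ (lam 2) (kroneckerPow s n))) ≠ 0 → ∃ (k : ℕ) (mu : Fin 3 → Nat.Partition (k * n)), 0 < k ∧ (∀ j, (mu j).parts = (lam j).parts.map (fun p => k * p)) ∧ isotypicSum₁ (mu 0) (isotypicSum₂ (mu 1) (isotypicSum₃ (mu 2) (kroneckerPow s₁ (k * n)))) ≠ 0) ∧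
          (∀ (n : ℕ) (lam : Fin 3 → Nat.Partition n), 0 < n → isotypicSum₁ (lam 0) (isotypicSum₂ (lam 1) (isotypicSum₃ (lam 2) (kroneckerPow s₁ n))) ≠ 0 → ∃ (k : ℕ) (mu : Fin 3 → Nat.Partition (k * n)), 0 < k ∧ (∀ j, (mu j).parts = (lam j).parts.map (fun p => k * p)) ∧ isotypicSum₁ (mu 0) (isotypicSum₂ (mu 1) (isotypicSum₃ (mu 2) (kroneckerPow s (k * n)))) ≠ 0) ∧
          (∀ (n : ℕ) (lam : Fin 3 → Nat.Partition n), 0 < n → isotypicSum₁ (lam 0) (isotypicSum₂ (lam 1) (isotypicSum₃ (lam 2) (kroneckerPow t n))) ≠ 0 → ∃ (k : ℕ) (mu : Fin 3 → Nat.Partition (k * n)), 0 < k ∧ (∀ j, (mu j).parts = (lam j).parts.map (fun p => k * p)) ∧ isotypicSum₁ (mu 0) (isotypicSum₂ (mu 1) (isotypicSum₃ (mu 2) (kroneckerPow t₁ (k * n)))) ≠ 0) ∧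
          (∀ (n : ℕ) (lam : Fin 3 → Nat.Partition n), 0 < n → isotypicSum₁ (lam 0) (isotypicSum₂ (lam 1) (isotypicSum₃ (lam 2) (kroneckerPow t₁ n))) ≠ 0 → ∃ (k : ℕ) (mu : Fin 3 → Nat.Partition (k * n)), 0 < k ∧ (∀ j, (mu j).parts = (lam j).parts.map (fun p => k * p)) ∧ isotypicSum₁ (mu 0) (isotypicSum₂ (mu 1) (isotypicSum₃ (mu 2) (kroneckerPow t (k * n)))) ≠ 0) ∧
          AlgDegeneratesTo t₁ s₁ := by
  sorry

/-- **stub 2 — degenerations are asymptotic restrictions** (provable-now): `t₁ ⊵ s₁` over `ℂ[ε]`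
gives `[s₁]^N ≤ (Nh+1)²·[t₁]^N` in `T(ℂ)`, a subexponential slack. [size M] -/
theorem stub_asympLe_of_algDegeneratesTo :
    ∀ {ι₁ κ₁ μ₁ ι₂ κ₂ μ₂ : Type} [Fintype ι₁] [Fintype κ₁] [Fintype μ₁] [Fintype ι₂] [Fintype κ₂]
        [Fintype μ₂] (s₁ : ι₁ → κ₁ → μ₁ → ℂ) (t₁ : ι₂ → κ₂ → μ₂ → ℂ), AlgDegeneratesTo t₁ s₁ →
        AsympLe (fun x y : TensorClass ℂ => x ≤ y) (TensorClass.mk s₁) (TensorClass.mk t₁) := by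
  sorry

/-- **Composition** (kernel-checked): cover + (degeneration ⟹ `≲`) ⟹ `DominationLifting`. -/
theorem DominationLifting_of
    (h₁ : ∀ {ι κ μ ι' κ' μ' : Type} [Fintype ι] [Fintype κ] [Fintype μ] [Fintype ι'] [Fintype κ'] [Fintype μ']
        (s : ι → κ → μ → ℂ) (t : ι' → κ' → μ' → ℂ),
        (∀ (n : ℕ) (lam : Fin 3 → Nat.Partition n), 0 < n → isotypicSum₁ (lam 0) (isotypicSum₂ (lam 1) (isotypicSum₃ (lam 2) (kroneckerPow s n))) ≠ 0 → ∃ (k : ℕ) (mu : Fin 3 → Nat.Partition (k * n)), 0 < k ∧ (∀ j, (mu j).parts = (lam j).parts.map (fun p => k * p)) ∧ isotypicSum₁ (mu 0) (isotypicSum₂ (mu 1) (isotypicSum₃ (mu 2) (kroneckerPow t (k * n)))) ≠ 0) →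
        ∃ (ι₁ κ₁ μ₁ ι₂ κ₂ μ₂ : Type) (_ : Fintype ι₁) (_ : Fintype κ₁) (_ : Fintype μ₁) (_ : Fintype ι₂)
          (_ : Fintype κ₂) (_ : Fintype μ₂) (s₁ : ι₁ → κ₁ → μ₁ → ℂ) (t₁ : ι₂ → κ₂ → μ₂ → ℂ),
          (∀ (n : ℕ) (lam : Fin 3 → Nat.Partition n), 0 < n → isotypicSum₁ (lam 0) (isotypicSum₂ (lam 1) (isotypicSum₃ (lam 2) (kroneckerPow s n))) ≠ 0 → ∃ (k : ℕ) (mu : Fin 3 → Nat.Partition (k * n)), 0 < k ∧ (∀ j, (mu j).parts = (lam j).parts.map (fun p => k * p)) ∧ isotypicSum₁ (mu 0) (isotypicSum₂ (mu 1) (isotypicSum₃ (mu 2) (kroneckerPow s₁ (k * n)))) ≠ 0) ∧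
          (∀ (n : ℕ) (lam : Fin 3 → Nat.Partition n), 0 < n → isotypicSum₁ (lam 0) (isotypicSum₂ (lam 1) (isotypicSum₃ (lam 2) (kroneckerPow s₁ n))) ≠ 0 → ∃ (k : ℕ) (mu : Fin 3 → Nat.Partition (k * n)), 0 < k ∧ (∀ j, (mu j).parts = (lam j).parts.map (fun p => k * p)) ∧ isotypicSum₁ (mu 0) (isotypicSum₂ (mu 1) (isotypicSum₃ (mu 2) (kroneckerPow s (k * n)))) ≠ 0) ∧
          (∀ (n : ℕ) (lam : Fin 3 → Nat.Partition n), 0 < n → isotypicSum₁ (lam 0) (isotypicSum₂ (lam 1) (isotypicSum₃ (lam 2) (kroneckerPow t n))) ≠ 0 → ∃ (k : ℕ) (mu : Fin 3 → Nat.Partition (k * n)), 0 < k ∧ (∀ j, (mu j).parts = (lam j).parts.map (fun p => k * p)) ∧ isotypicSum₁ (mu 0) (isotypicSum₂ (mu 1) (isotypicSum₃ (mu 2) (kroneckerPow t₁ (k * n)))) ≠ 0) ∧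
          (∀ (n : ℕ) (lam : Fin 3 → Nat.Partition n), 0 < n → isotypicSum₁ (lam 0) (isotypicSum₂ (lam 1) (isotypicSum₃ (lam 2) (kroneckerPow t₁ n))) ≠ 0 → ∃ (k : ℕ) (mu : Fin 3 → Nat.Partition (k * n)), 0 < k ∧ (∀ j, (mu j).parts = (lam j).parts.map (fun p => k * p)) ∧ isotypicSum₁ (mu 0) (isotypicSum₂ (mu 1) (isotypicSum₃ (mu 2) (kroneckerPow t (k * n)))) ≠ 0) ∧
          AlgDegeneratesTo t₁ s₁)
    (h₂ : ∀ {ι₁ κ₁ μ₁ ι₂ κ₂ μ₂ : Type} [Fintype ι₁] [Fintype κ₁] [Fintype μ₁] [Fintype ι₂] [Fintype κ₂]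
        [Fintype μ₂] (s₁ : ι₁ → κ₁ → μ₁ → ℂ) (t₁ : ι₂ → κ₂ → μ₂ → ℂ), AlgDegeneratesTo t₁ s₁ →
        AsympLe (fun x y : TensorClass ℂ => x ≤ y) (TensorClass.mk s₁) (TensorClass.mk t₁)) :
    DominationLifting := by
  intro ι κ μ ι' κ' μ' _ _ _ _ _ _ s t hdom
  obtain ⟨ι₁, κ₁, μ₁, ι₂, κ₂, μ₂, i₁, i₂, i₃, i₄, i₅, i₆, s₁, t₁, hss₁, hs₁s, htt₁, ht₁t, hdeg⟩ :=
    h₁ s t hdom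
  exact ⟨ι₁, κ₁, μ₁, ι₂, κ₂, μ₂, i₁, i₂, i₃, i₄, i₅, i₆, s₁, t₁, hss₁, hs₁s, htt₁, ht₁t,
    h₂ s₁ t₁ hdeg⟩

end Summit.MatrixMultiplication.MatrixMultiplication.Cruxes.DominationLifting.Birth

end
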